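import Summits.Ventures.PercRepro.ProfilePointedCircuitClassesStarSharpY

/-! # The six-point lemma, II: the equal-split double count (p5 g53, §80 ADD 7(e)–(f))

`sixpoint_double_count_abstract` is the pure counting core: on a finite set `Q` with a symmetric relation `R`
(«`{u, v}` is an ON pair of `BI`»), a predicate `G` («`{f, u} ∈ BI`») and a predicate `H` («`{f, u}` is ON»),
if every `R`-pair has a `G`-endpoint (F0) and the load `Σ_{v : R u v} (2 − [G v])` of every `G`-point `u` is at
most `2 + 2·[H u]` (P-OFF / P-ON), then the number of ORDERED `R`-pairs is at most `4·#(G ∧ H) + 2·#(G ∧ ¬H)`. -/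

open scoped Matroid

namespace PercRepro.Cogirth

open Finset

section StarSharpZ

variable {α : Type} [DecidableEq α]

/-- **The equal-split double count**: ordered `R`-pairs of `Q` number at most `4·#(G ∧ H) + 2·#(G ∧ ¬H)` when
(F0) every `R`-pair has a `G`-endpoint and (L) every `G`-point `u` has load `Σ_{v ∈ Q − u, R u v} (if G v then 1 else 2)`
at most `2 + 2·[H u]`. -/
theorem sixpoint_double_count_abstract (Q : Finset α) (R : α → α → Prop) [DecidableRel R] (G H : α → Prop)
    [DecidablePred G] [DecidablePred H] (hsym : ∀ u v, R u v → R v u) (hirr : ∀ u ∈ Q, ¬ R u u)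
    (hF0 : ∀ u ∈ Q, ∀ v ∈ Q, u ≠ v → R u v → G u ∨ G v)
    (hL : ∀ u ∈ Q, G u → ∑ v ∈ (Q.erase u).filter (R u), (if G v then (1 : ℕ) else 2) ≤ 2 + 2 * (if H u then 1 else 0)) :
    ((Q ×ˢ Q).filter (fun p => p.1 ≠ p.2 ∧ R p.1 p.2)).card ≤
      4 * (Q.filter (fun u => G u ∧ H u)).card + 2 * (Q.filter (fun u => G u ∧ ¬ H u)).card := by
  set P := (Q ×ˢ Q).filter (fun p => p.1 ≠ p.2 ∧ R p.1 p.2) with hP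
  -- split by G at the first coordinate
  have hsplit := card_filter_add_card_filter_not (s := P) (fun p => G p.1)
  -- the pairs with ¬G at the first coordinate inject (by swapping) into the pairs with G first and ¬G second
  have hinj : (P.filter (fun p => ¬ G p.1)).card ≤ ((P.filter (fun p => G p.1)).filter (fun p => ¬ G p.2)).card := by
    apply card_le_card_of_injOn Prod.swap
    · intro p hp
      simp only [hP, mem_coe, mem_filter, mem_product, Prod.fst_swap, Prod.snd_swap] at hp ⊢
      obtain ⟨⟨⟨h1, h2⟩, hne, hR⟩, hnG⟩ := hp
      have hG : G p.2 := (hF0 p.1 h1 p.2 h2 hne hR).resolve_left hnG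
      exact ⟨⟨⟨⟨h2, h1⟩, fun h => hne h.symm, hsym _ _ hR⟩, hG⟩, hnG⟩
    · intro p _ q _ hpq
      exact Prod.swap_injective hpq
  -- the weighted count over the G-first pairs
  have hw : (P.filter (fun p => G p.1)).card + ((P.filter (fun p => G p.1)).filter (fun p => ¬ G p.2)).card =
      ∑ p ∈ P.filter (fun p => G p.1), (if G p.2 then (1 : ℕ) else 2) := by
    rw [card_eq_sum_ones ((P.filter (fun p => G p.1)).filter (fun p => ¬ G p.2)), sum_filter,
      card_eq_sum_ones (P.filter (fun p => G p.1)), ← sum_add_distrib]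
    apply sum_congr rfl
    intro p _
    split_ifs <;> omega
  -- regroup by the first coordinate
  have hre : ∑ p ∈ P.filter (fun p => G p.1), (if G p.2 then (1 : ℕ) else 2) =
      ∑ u ∈ Q.filter G, ∑ v ∈ (Q.erase u).filter (R u), (if G v then (1 : ℕ) else 2) := by
    rw [hP, filter_filter, sum_filter, sum_product, sum_filter]
    apply sum_congr rfl
    intro u hu
    rw [sum_filter, sum_erase Q (f := fun a => if R u a then (if G a then (1 : ℕ) else 2) else 0)
      (by simp only [hirr u hu, if_false])]
    split_ifs with hG
    · apply sum_congr rfl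
      intro y _
      dsimp only
      by_cases hyu : u = y
      · subst hyu
        rw [if_neg (fun h => h.1.1 rfl), if_neg (hirr u hu)]
      · by_cases hR : R u y
        · rw [if_pos ⟨⟨hyu, hR⟩, hG⟩, if_pos hR]
        · rw [if_neg (fun h => hR h.1.2), if_neg hR]
    · apply sum_eq_zero
      intro y _
      dsimp only
      exact if_neg (fun h => hG h.2)
  -- the load bound, summed
  have hsum : ∑ u ∈ Q.filter G, ∑ v ∈ (Q.erase u).filter (R u), (if G v then (1 : ℕ) else 2) ≤
      ∑ u ∈ Q.filter G, (2 + 2 * (if H u then 1 else 0)) := by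
    apply sum_le_sum
    intro u hu
    exact hL u (mem_filter.1 hu).1 (mem_filter.1 hu).2
  have hfin : ∑ u ∈ Q.filter G, (2 + 2 * (if H u then (1 : ℕ) else 0)) =
      4 * (Q.filter (fun u => G u ∧ H u)).card + 2 * (Q.filter (fun u => G u ∧ ¬ H u)).card := by
    rw [sum_add_distrib, ← mul_sum, ← sum_filter, filter_filter, card_eq_sum_ones, card_eq_sum_ones]
    have h2 := card_filter_add_card_filter_not (s := Q.filter G) H
    rw [filter_filter, filter_filter] at h2
    rw [sum_const, smul_eq_mul, ← card_eq_sum_ones, ← card_eq_sum_ones]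
    omega
  omega

/-- The load of an OFF point is at most `2`: among three candidate pairs not all three are ON, and any two ON pairs
force the share `1` on each of them. -/
theorem load_three_off (R1 R2 R3 G1 G2 G3 : Prop) [Decidable R1] [Decidable R2] [Decidable R3] [Decidable G1]
    [Decidable G2] [Decidable G3] (hnot3 : ¬ (R1 ∧ R2 ∧ R3)) (h12 : R1 → R2 → G1) (h21 : R1 → R2 → G2)
    (h13 : R1 → R3 → G1) (h31 : R1 → R3 → G3) (h23 : R2 → R3 → G2) (h32 : R2 → R3 → G3) :
    (if R1 then (if G1 then (1 : ℕ) else 2) else 0) + ((if R2 then (if G2 then (1 : ℕ) else 2) else 0) +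
      (if R3 then (if G3 then (1 : ℕ) else 2) else 0)) ≤ 2 := by
  by_cases r1 : R1 <;> by_cases r2 : R2 <;> by_cases r3 : R3
  · exact absurd ⟨r1, r2, r3⟩ hnot3
  · rw [if_pos r1, if_pos r2, if_neg r3, if_pos (h12 r1 r2), if_pos (h21 r1 r2)]
  · rw [if_pos r1, if_neg r2, if_pos r3, if_pos (h13 r1 r3), if_pos (h31 r1 r3)]
  · rw [if_pos r1, if_neg r2, if_neg r3]
    split_ifs <;> omega
  · rw [if_neg r1, if_pos r2, if_pos r3, if_pos (h23 r2 r3), if_pos (h32 r2 r3)]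
  · rw [if_neg r1, if_pos r2, if_neg r3]
    split_ifs <;> omega
  · rw [if_neg r1, if_neg r2, if_pos r3]
    split_ifs <;> omega
  · rw [if_neg r1, if_neg r2, if_neg r3]
    omega

/-- The load of an ON point is at most `4`: if all three candidate pairs are ON, at least two carry the share `1`. -/
theorem load_three_on (R1 R2 R3 G1 G2 G3 : Prop) [Decidable R1] [Decidable R2] [Decidable R3] [Decidable G1]
    [Decidable G2] [Decidable G3] (hall : R1 → R2 → R3 → (G1 ∧ G2) ∨ (G1 ∧ G3) ∨ (G2 ∧ G3)) :
    (if R1 then (if G1 then (1 : ℕ) else 2) else 0) + ((if R2 then (if G2 then (1 : ℕ) else 2) else 0) +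
      (if R3 then (if G3 then (1 : ℕ) else 2) else 0)) ≤ 4 := by
  by_cases r1 : R1 <;> by_cases r2 : R2 <;> by_cases r3 : R3
  · rw [if_pos r1, if_pos r2, if_pos r3]
    rcases hall r1 r2 r3 with ⟨g1, g2⟩ | ⟨g1, g3⟩ | ⟨g2, g3⟩
    · rw [if_pos g1, if_pos g2]
      split_ifs <;> omega
    · rw [if_pos g1, if_pos g3]
      split_ifs <;> omega
    · rw [if_pos g2, if_pos g3]
      split_ifs <;> omega
  all_goals simp only [r1, r2, r3, if_true, if_false]
  all_goals first | omega | (split_ifs <;> omega)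

end StarSharpZ

section StarSharpZ2

variable {α : Type} [DecidableEq α] {N : Matroid α} [N.Finite]

open ThmH Skew Shadow Profile

/-- The three-element set `{v₁, v₂, v₃}` minus each of its points. -/
theorem triple_erase_eq {v₁ v₂ v₃ : α} (h12 : v₁ ≠ v₂) (h13 : v₁ ≠ v₃) (h23 : v₂ ≠ v₃) :
    ({v₁, v₂, v₃} : Finset α).erase v₁ = {v₂, v₃} ∧ ({v₁, v₂, v₃} : Finset α).erase v₂ = {v₁, v₃} ∧
      ({v₁, v₂, v₃} : Finset α).erase v₃ = {v₁, v₂} := by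
  refine ⟨?_, ?_, ?_⟩
  · rw [erase_insert]
    simp only [mem_insert, mem_singleton, not_or]
    exact ⟨h12, h13⟩
  · rw [erase_insert_of_ne h12, erase_insert]
    simp only [mem_singleton]
    exact h23
  · rw [erase_insert_of_ne h13, erase_insert_of_ne h23, erase_singleton]
    rfl

/-- **THE SIX-POINT LEMMA** (§80 ADD 7(f), strong form), in rank terms modulo `B`: `Q` has four points, `f ∉ Q` is
not a coloop (`ρ(Q ∪ B) ≥ r + 3`); an ordered pair `(u, v)` of distinct points of `Q` is counted when `{u, v}` is
independent, `{f} ∪ (Q − u − v)` is a basis and `b ∈ cl{u, v}` (all modulo `B`); a point `u` is «`G`» when `{f, u}`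
is independent with `Q − u` a basis, and «`H`» when moreover `b ∈ cl{f, u}`.  Then
`#(ordered ON pairs avoiding f) ≤ 4·#(G ∧ H) + 2·#(G ∧ ¬H)`, i.e. `#{π ∌ f ON} ≤ 2·#{π ∋ f ON} + #{π ∋ f OFF}`. -/
theorem sixpoint_lemma {B Q : Finset α} {f b : α} (hB : B ⊆ gr N) (hQ : Q ⊆ gr N) (hf : f ∈ gr N) (hb : b ∈ gr N)
    (hQ4 : Q.card = 4) (hfnc : rk N B + 3 ≤ rk N (Q ∪ B)) :
    ((Q ×ˢ Q).filter (fun p => p.1 ≠ p.2 ∧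
      ((rk N B + 2 ≤ rk N ({p.1, p.2} ∪ B) ∧ rk N B + 3 ≤ rk N (insert f ((Q.erase p.1).erase p.2) ∪ B)) ∧
        rk N ({p.1, p.2, b} ∪ B) ≤ rk N B + 2))).card ≤
      4 * (Q.filter (fun u => (rk N B + 2 ≤ rk N ({f, u} ∪ B) ∧ rk N B + 3 ≤ rk N (Q.erase u ∪ B)) ∧
          rk N ({f, u, b} ∪ B) ≤ rk N B + 2)).card +
        2 * (Q.filter (fun u => (rk N B + 2 ≤ rk N ({f, u} ∪ B) ∧ rk N B + 3 ≤ rk N (Q.erase u ∪ B)) ∧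
          ¬ rk N ({f, u, b} ∪ B) ≤ rk N B + 2)).card := by
  refine sixpoint_double_count_abstract Q
    (fun u v => (rk N B + 2 ≤ rk N ({u, v} ∪ B) ∧ rk N B + 3 ≤ rk N (insert f ((Q.erase u).erase v) ∪ B)) ∧
        rk N ({u, v, b} ∪ B) ≤ rk N B + 2)
    (fun u => rk N B + 2 ≤ rk N ({f, u} ∪ B) ∧ rk N B + 3 ≤ rk N (Q.erase u ∪ B))
    (fun u => rk N ({f, u, b} ∪ B) ≤ rk N B + 2) ?_ ?_ ?_ ?_
  · -- symmetry
    intro u v ⟨⟨h1, h2⟩, h3⟩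
    refine ⟨⟨?_, ?_⟩, ?_⟩
    · rw [pair_union_swap]; exact h1
    · rw [erase_right_comm]; exact h2
    · rw [triple_union_swap12]; exact h3
  · -- irreflexivity
    intro u hu ⟨⟨h1, _⟩, _⟩
    have e : ({u, u} : Finset α) ∪ B = {u} ∪ B := by rw [insert_eq_of_mem (mem_singleton_self u)]
    rw [e] at h1
    have := rk_singleton_union_le_add_one (N := N) (hQ hu) hB
    omega
  · -- (F0)
    intro u hu v hv huv ⟨⟨h1, h2⟩, _⟩
    have hvQu : v ∈ Q.erase u := mem_erase.2 ⟨fun h => huv h.symm, hv⟩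
    have hcard : ((Q.erase u).erase v).card = 2 := by
      rw [card_erase_of_mem hvQu, card_erase_of_mem hu, hQ4]
    obtain ⟨w, w', _, hWW⟩ := card_eq_two.1 hcard
    have hwQ : w ∈ Q := mem_of_mem_erase (mem_of_mem_erase (hWW ▸ mem_insert_self w {w'}))
    have hw'Q : w' ∈ Q := mem_of_mem_erase (mem_of_mem_erase (hWW ▸ mem_insert_of_mem (mem_singleton_self w')))
    have hQeq : Q = {u, v, w, w'} := by
      rw [← insert_erase hu, ← insert_erase hvQu, hWW]
    have hfww : rk N B + 3 ≤ rk N ({f, w, w'} ∪ B) := by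
      rw [hWW] at h2; exact h2
    have hQr : rk N B + 3 ≤ rk N ({u, v, w, w'} ∪ B) := by rw [← hQeq]; exact hfnc
    rcases sixpoint_F0 (N := N) hB hf (hQ hu) (hQ hv) (hQ hwQ) (hQ hw'Q) h1 hfww hQr with ⟨ha, hb'⟩ | ⟨ha, hb'⟩
    · left
      refine ⟨ha, ?_⟩
      have e : Q.erase u = {v, w, w'} := by rw [← insert_erase hvQu, hWW]
      rw [e]; exact hb'
    · right
      refine ⟨ha, ?_⟩
      have huQv : u ∈ Q.erase v := mem_erase.2 ⟨huv, hu⟩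
      have e : Q.erase v = {u, w, w'} := by rw [← insert_erase huQv, erase_right_comm, hWW]
      rw [e]; exact hb'
  · -- (L): the load bound
    intro u hu hG
    obtain ⟨_, hG2⟩ := hG
    have hcard : (Q.erase u).card = 3 := by rw [card_erase_of_mem hu, hQ4]
    obtain ⟨v₁, v₂, v₃, h12, h13, h23, hQe⟩ := card_eq_three.1 hcard
    have hm1 : v₁ ∈ Q.erase u := hQe ▸ mem_insert_self v₁ {v₂, v₃}
    have hm2 : v₂ ∈ Q.erase u := hQe ▸ mem_insert_of_mem (mem_insert_self v₂ {v₃})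
    have hm3 : v₃ ∈ Q.erase u := hQe ▸ mem_insert_of_mem (mem_insert_of_mem (mem_singleton_self v₃))
    have hu1 : u ≠ v₁ := fun h => (mem_erase.1 hm1).1 h.symm
    have hu2 : u ≠ v₂ := fun h => (mem_erase.1 hm2).1 h.symm
    have hu3 : u ≠ v₃ := fun h => (mem_erase.1 hm3).1 h.symm
    have hg1 : v₁ ∈ gr N := hQ (mem_of_mem_erase hm1)
    have hg2 : v₂ ∈ gr N := hQ (mem_of_mem_erase hm2)
    have hg3 : v₃ ∈ gr N := hQ (mem_of_mem_erase hm3)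
    obtain ⟨e1, e2, e3⟩ := triple_erase_eq h12 h13 h23
    have hQ' : Q = insert u {v₁, v₂, v₃} := by rw [← hQe, insert_erase hu]
    have hQe1 : Q.erase v₁ = {u, v₂, v₃} := by rw [hQ', erase_insert_of_ne hu1, e1]
    have hQe2 : Q.erase v₂ = {u, v₁, v₃} := by rw [hQ', erase_insert_of_ne hu2, e2]
    have hQe3 : Q.erase v₃ = {u, v₁, v₂} := by rw [hQ', erase_insert_of_ne hu3, e3]
    rw [hQe] at hG2
    rw [hQe, sum_filter, sum_insert (by simp only [mem_insert, mem_singleton, not_or]; exact ⟨h12, h13⟩),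
      sum_insert (by simp only [mem_singleton]; exact h23), sum_singleton, e1, e2, e3, hQe1, hQe2, hQe3]
    by_cases hH : rk N ({f, u, b} ∪ B) ≤ rk N B + 2
    · rw [if_pos hH]
      apply load_three_on
      rintro ⟨⟨huv₁, hc₁⟩, _⟩ ⟨⟨huv₂, hc₂⟩, _⟩ ⟨⟨huv₃, _⟩, _⟩
      exact sixpoint_PON (N := N) hB hf hg1 hg2 hg3 hG2 huv₁ huv₂ huv₃ hc₁ hc₂
    · rw [if_neg hH]
      rw [not_le] at hH
      have hoff : rk N B + 3 ≤ rk N ({f, u, b} ∪ B) := hH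
      apply load_three_off
      · rintro ⟨⟨⟨_, _⟩, ho1⟩, ⟨⟨_, _⟩, ho2⟩, ⟨⟨_, _⟩, ho3⟩⟩
        rw [triple_union_swap23] at ho1 ho2 ho3
        exact sixpoint_POFF_not_three (N := N) hB hf (hQ hu) hb hoff hG2 ho1 ho2 ho3
      · rintro ⟨⟨huv₁, _⟩, ho1⟩ ⟨⟨huv₂, _⟩, ho2⟩
        rw [triple_union_swap23] at ho1 ho2
        exact sixpoint_POFF_fvBI (N := N) hB hf (hQ hu) hb hg1 hoff hG2 huv₁ huv₂ ho1 ho2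
      · rintro ⟨⟨huv₁, _⟩, ho1⟩ ⟨⟨huv₂, _⟩, ho2⟩
        rw [triple_union_swap23] at ho1 ho2
        have hG2' := hG2
        rw [triple_union_swap12] at hG2'
        exact sixpoint_POFF_fvBI (N := N) hB hf (hQ hu) hb hg2 hoff hG2' huv₂ huv₁ ho2 ho1
      · rintro ⟨⟨huv₁, _⟩, ho1⟩ ⟨⟨huv₃, _⟩, ho3⟩
        rw [triple_union_swap23] at ho1 ho3
        have hG2' := hG2
        rw [triple_union_swap23] at hG2'
        have := sixpoint_POFF_fvBI (N := N) hB hf (hQ hu) hb hg1 hoff hG2' huv₁ huv₃ ho1 ho3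
        rw [triple_union_swap23] at this
        exact this
      · rintro ⟨⟨huv₁, _⟩, ho1⟩ ⟨⟨huv₃, _⟩, ho3⟩
        rw [triple_union_swap23] at ho1 ho3
        have hG2' := hG2
        rw [triple_union_rot, triple_union_rot] at hG2'
        exact sixpoint_POFF_fvBI (N := N) hB hf (hQ hu) hb hg3 hoff hG2' huv₃ huv₁ ho3 ho1
      · rintro ⟨⟨huv₂, _⟩, ho2⟩ ⟨⟨huv₃, _⟩, ho3⟩
        rw [triple_union_swap23] at ho2 ho3
        have hG2' := hG2
        rw [triple_union_rot] at hG2'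
        have := sixpoint_POFF_fvBI (N := N) hB hf (hQ hu) hb hg2 hoff hG2' huv₂ huv₃ ho2 ho3
        rw [triple_union_swap23] at this
        exact this
      · rintro ⟨⟨huv₂, _⟩, ho2⟩ ⟨⟨huv₃, _⟩, ho3⟩
        rw [triple_union_swap23] at ho2 ho3
        have hG2' := hG2
        rw [triple_union_rev] at hG2'
        have := sixpoint_POFF_fvBI (N := N) hB hf (hQ hu) hb hg3 hoff hG2' huv₃ huv₂ ho3 ho2
        rw [triple_union_swap23] at this
        exact this

end StarSharpZ2

end PercRepro.Cogirth
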